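import Literature.MathematicalPhysics.QuantumFieldTheory.Balaban1983to89.B9Thm33DeltaAAtKnitLetterOfRegYP335

/-!
# `Balaban1983to89.B9Thm311PosDefQknitAtKnitLetterLawFreeY` — T. Bałaban, *Propagators for lattice gauge theories in a background field*, Commun. Math. Phys. **99**
# (1985) 389–434 [Balaban1985BackgroundPropagators], THEOREM 3.11 p. 416 («Δ_a(U) … is a symmetric and invertible operator», positive with a gap) AT THE KNIT
# LETTER OF RECORD `(qKnitOfRecord, qsKnitOfRecord, parKnitY, GpY parKnitY)` ON PRINT's CLASS (3.35), LAW-FREE at section-carrying members: the last displayed law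
# of `B9Thm311PosDefQknitAtKnitSiteTableY` (Theorem 3.3's block at `parKnitY`) is DISCHARGED by `B9Thm33DeltaAAtKnitLetterOfRegYP335` in majorant currency

statement-level skeleton of published theorems with citation tags; proofs where landed; nothing here is a claim about the Yang–Mills mass gap

THE PRINT.  Thm 3.11 p. 416; Thm 3.3 p. 399 ((3.42) p. 397 for `G = Δ_a⁻¹`); (3.19) p. 393; (3.20)–(3.27) pp. 394–395; (3.35) p. 396; (3.69) p. 404; (3.115) p. 419;
[4] = *Propagators … II*, Commun. Math. Phys. **96** (1984), Lemma 2.1 (2.60)–(2.61) p. 234, (2.51)–(2.52) p. 232; [5] = *Averaging operations …*, Commun. Math. Phys.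
**98** (1985), Prop. 2 (52)–(53) p. 26, (139)–(147) pp. 39–40.

WHY THIS FILE (cell `pub-ymgap`, node N06, seat `dag-n06-j` gen 36 = bundle F5, row 17; CASCADE-K).  `B9Thm311FormGapOfLawsAtLettersY` (✓) re-presses Theorem
3.11's scale-weighted gap and row 17 at a parametric site transporter from four displayed laws, the second being Theorem 3.3's block in `EBlock` currency; the gap
proof uses that block ONLY through lit-balaban's dictionary `hasMajorant_conj_G_of_eBlockInvB`, i.e. through the majorant `conj b(G^ℝ) ≺ C·ℓ(a)²·e^{−δd}` over
`(toB6 (geo9K x) 0 True, ιB∘blkV1)`.  `B9Thm33DeltaAAtKnitLetterOfRegYP335` (file 8b of this seat's chain) proves exactly `IsUnit Δ_a(U; parKnitY)` AND that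
majorant at `parKnitY` for every section-carrying member of (3.35) above one threshold; `B9Thm311PosDefQknitAtKnitSiteTableY` (✓) proves the other two laws
(`Δ_a` symmetric, `R ≥ 0`) at `parKnitY`.  THIS FILE (§1–§2) re-presses the gap and row 17 with the block law stated in MAJORANT currency (the `EBlock`
hypothesis replaced by its only use), and (§3) discharges every law and every knit numeric at the knit site table: the gap of `Δ_a(U; parKnitY)`, and the
symmetry-and-positivity of `Δ_a^𝔮(U)` at the knit pair of record — the conjunction dag-n06-d's «KA»∕«KB» certificates display as `hΔAK` — with NO displayed
law, for section-carrying members (`β` onto), in print's smallness shape `M₁ ≦ M`, `M·α₀ ≦ a₁` (resp. `≦ a₁∕c` on the regime of record).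

WHAT IS PROVED (sorry-free; 0 `def`).  ★★ `formGap_deltaAY_of_majorant` (§1: `formGap_deltaAY_of_laws` with the block law in majorant currency — proof verbatim,
`C₀ := K_A`) · ★★ `posDefTr_deltaAQY_QknitY_of_majorant` (§2: row 17 at `QknitY`, parametric `(parS, Gp)`, same currency) · ★★★ `formGap_deltaAY_parKnitY_at_scMember`
(§3: the gap at `(parKnitY, GpY parKnitY)`, law-free) · ★★★ `symm_posDefTr_deltaAQY_knitRecord_at_scMember` (row 17 + symmetry at the knit record, law-free, the
closeness numeric `δ(2√(2b₁)+δ) < γ` discharged by fixing `α₀′` inside, the knit numerics `K_pl(Mα₀)L⁴ < α₀′ ≤ α_Q` folded into `M·α₀ ≦ a₁`) · ★★★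
`symm_posDefTr_deltaAQY_knitRecord_at_scMember_regYR` (the same on the regime of record `bg9YR … R₁ R₂`, inclusion `hRP1` displayed, smallness `M·α₀ ≦ a₁∕c`).
HONEST SCOPE.  Assembly of landed theorems; the surjectivity of `β` (section-carrying members) stays a hypothesis; NOT a node discharge; count-neutral; nothing
continuum ∕ OS ∕ mass gap ∕ Clay.  No `sorry`, no `axiom`, no `instance`, no `notation`, no `def`.
-/

noncomputable section

namespace Literature.MathematicalPhysics.QuantumFieldTheory.Balaban1983to89.B9Thm311PosDefQknitAtKnitLetterLawFreeY

open Literature.MathematicalPhysics.QuantumFieldTheory.Balaban1983to89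
open B6RandomWalk B9Thm311ReadingCoords B9Thm39ReadingCoords B9Thm39ReadingAtLetters Node00
open B6KLevelCensusIndexV1 B6Ineq2142KLevelV1 B6GlobalChartV1 B9PinMembersKLevelV1 B9PinGeometryKLevelV1 B9GeoNormsKLevelV1
  B9BackgroundsKLevelV1 B9BackgroundsKLevelV1P B9Thm34Ext
open B9Thm311PosDefViaSpectralGap B9Thm311HessianWeightedLowerBoundY B9Thm311EigenBoundOfMajorant B9Thm310DeltaAIsUnitOfRegYP335AtLettersY
open B9Thm311PosDefOfRegYP335AtLettersY B9Thm311FormGapOfRegYP335AtLettersY B9Thm311PosDefAveragingSwap B9Eq315QYSizeWeightedL2Y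
  B9Thm311PosDefAveragingSwapClose B9Eq315QLetterL2SizeFromClosenessY
open B9Thm311FormGapOfLawsAtLettersY B9Thm311PosDefQknitAtKnitSiteTableY
open Literature.MathematicalPhysics.QuantumFieldTheory.Balaban1983to89.B9Thm37Sum (mulOp mulOp_apply)
open Literature.MathematicalPhysics.QuantumFieldTheory.Balaban1983to89.B9Thm37CubeCoverCommutators (cutMulY cutMulY_apply)
open Literature.MathematicalPhysics.QuantumFieldTheory.Balaban1983to89.B9Eq352DivFormLetters (conj conj_apply coordEquiv)
open Literature.MathematicalPhysics.QuantumFieldTheory.Balaban1983to89.B9GeoLemma21KLevelV1 (rowSum_geo9K_core transferL_geo9K geo9K_dist_comm geo9K_dist_nonneg' geo9K_len_pos geo9K_one_le_L)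
open Literature.MathematicalPhysics.QuantumFieldTheory.Balaban1983to89.B6Cor28 (TransferL)
open Literature.MathematicalPhysics.QuantumFieldTheory.Balaban1983to89.B6RandomWalk (HasMajorant hasMajorant_mono)
open Literature.MathematicalPhysics.QuantumFieldTheory.Balaban1983to89.B9Ineq369CurvatureSmallAtLettersY (hs_nonneg trIP_one_self_eq)
open Literature.MathematicalPhysics.QuantumFieldTheory.Balaban1983to89.B9Thm39OneCubeReadingAtLettersY (geo9Y_M_nonneg)
open Literature.MathematicalPhysics.QuantumFieldTheory.Balaban1983to89.B9SectBCodedClassR (bg9YC extraYPb)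
open Literature.MathematicalPhysics.QuantumFieldTheory.Balaban1983to89.B9SectionCarryingMembersV1 (SCMemberY)
open Literature.MathematicalPhysics.QuantumFieldTheory.Balaban1983to89.B9Thm311DeltaPrimePos (trIP_add_right trIP_self_nonneg trIP_self_pos)
open Literature.MathematicalPhysics.QuantumFieldTheory.Balaban1983to89.B9Ineq349SiteAdjoint (trIP_comm)
open Literature.MathematicalPhysics.QuantumFieldTheory.Balaban1983to89.B9Thm311ProjectionR (trIP_aY_eq)
open Literature.MathematicalPhysics.QuantumFieldTheory.Balaban1983to89.B9Thm311AdjointPairs (isAdjTr_QY_QsY_parBY isAdjTr_gradY_divY)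
open Literature.MathematicalPhysics.QuantumFieldTheory.Balaban1983to89.B9Thm311FlippedBondForms (trIP_self_eq_sum)
open B9Thm311PosDefQknitOfRegYP335AtLettersY B9Eq3115KnitLetterYRowCloseness
open Literature.MathematicalPhysics.QuantumFieldTheory.Balaban1983to89.B9Eq3115KnitLetterY (QknitY zSrc)
open Literature.MathematicalPhysics.QuantumFieldTheory.Balaban1983to89.B9Eq3115KnitLetterYOnto (kCol kCol_nonneg)
open Literature.MathematicalPhysics.QuantumFieldTheory.Balaban1983to89.B9Eq316AveragingTransposeZd (alphaQ alphaQ_pos)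
open Literature.MathematicalPhysics.QuantumFieldTheory.Balaban1983to89.B9C2FormBoxRegimeY (Kpl)
open Literature.MathematicalPhysics.QuantumFieldTheory.Balaban1983to89.B9B8AveragingJunction (parKnitY)
open Literature.MathematicalPhysics.QuantumFieldTheory.Balaban1983to89.Node00.OpsYQLetter (qKnitOfRecord qsKnitOfRecord isAdjTr_adjTrY adjTrY)
open Literature.MathematicalPhysics.QuantumFieldTheory.Balaban1983to89.B9Thm33DeltaAAtKnitLetterOfRegYP335 (isUnit_deltaAY_parKnitY_and_majorant_of_regYP335_section Kpl_lt_of_le)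
open scoped InnerProductSpace

/-! ## §1 ★★ The scale-weighted gap of `Δ_a(U)` at a parametric `(parS, Gp)`, Theorem 3.3's block in majorant currency -/

section Record

open scoped Matrix.Norms.L2Operator
open B7Prop2SpecialUnitary

variable {N : ℕ} [Nonempty (Fin N)] (θ : Stage3Params) (Mstar : ℕ)

omit [Nonempty (Fin N)] in
/-- ★★ **THEOREM 3.11 WITH A GAP AT A PARAMETRIC SITE TRANSPORTER, THEOREM 3.3's BLOCK IN MAJORANT CURRENCY**: `formGap_deltaAY_of_laws` with its `EBlock` law replaced
by the one consequence its proof uses — for every section `ιB` of `β`, `conj b(G(U)^ℝ) ≺ K_A·ℓ(a)²·e^{−δ_A d(a,a′)}` over `(toB6 (geo9K x) 0 True, ιB∘blkV1)`, `b = basis39`,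
`G = GAY x parS parBY Gp`.  With `IsUnit Δ_a(U)`, `Δ_a(U)` symmetric and `R(U) ≥ 0`: `γ·Σ_b c_f²(L^{lev b})⁻²‖A(b)‖²_HS ≤ ⟨A, Δ_a(U)A⟩₁`.  Proof = that of
`formGap_deltaAY_of_laws` verbatim with `C₀ := K_A`. [cite: Balaban1985BackgroundPropagators, Thm 3.11 p.416; Thm 3.3 p.399; (3.26) p.395; (3.41) p.397; (3.69) p.404; Balaban1984PropagatorsII, Lemma 2.1 (2.60)–(2.61) p.234, (2.51)–(2.52) p.232] -/
theorem formGap_deltaAY_of_majorant [∀ i' : KIdx θ.d₆ θ.ℓ₆ θ.hd' θ.hL' θ.b₀ θ.b₁, Fintype (geo9K i').Site] (hN : 1 ≤ N) {δA KA : ℝ} (hδA : 0 < δA)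
    (hKA : 0 ≤ KA) :
    ∃ M₁ a₁ γ : ℝ, 0 < M₁ ∧ 0 < a₁ ∧ 0 < γ ∧
    ∀ (x : MemberY θ.d₆ θ.ℓ₆ θ.hd' θ.hL' θ.b₀ θ.b₁ Mstar), Function.Surjective (β x.hN x.D x.hk) → M₁ ≤ (geo9Y x).M →
      ∀ α₀ : ℝ, 0 < α₀ → (geo9Y x).M * α₀ ≤ a₁ →
      ∀ U : CfgY (Matrix (Fin N) (Fin N) ℂ) x.toKIdx,
        (bg9YP (Matrix (Fin N) (Fin N) ℂ) (specialUnitaryUnits (Fin N)) x).Reg335 c35Y α₀ U →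
        ∀ (parS : SiteParY (Matrix (Fin N) (Fin N) ℂ) x.toKIdx) (Gp : SiteOpY (Matrix (Fin N) (Fin N) ℂ) x.toKIdx),
          IsUnit (deltaAY x.toKIdx parS (parBY x.toKIdx) Gp U) →
          (∀ (ιB : BlkY x.toKIdx → IBondY x.toKIdx), (∀ s, β x.hN x.D x.hk (ιB s) = s) →
            HasMajorant (g := toB6 (geo9K x.toKIdx) 0 True) (fun p : FBondY x.toKIdx × κ39 (Matrix (Fin N) (Fin N) ℂ) => ιB (blkV1 x.hN x.D p.1))
              (conj (basis39 (Matrix (Fin N) (Fin N) ℂ)) ((GAY x.toKIdx parS (parBY x.toKIdx) Gp U).restrictScalars ℝ))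
              (fun a a' => KA * (geo9K x.toKIdx).len a ^ 2 * Real.exp (-(δA * (geo9K x.toKIdx).dist a a')))) →
          IsSymmTr (fun _ => (1 : ℝ)) (deltaAY x.toKIdx parS (parBY x.toKIdx) Gp U) →
          (∀ f, 0 ≤ trIP (fun _ => (1 : ℝ)) f (RY x.toKIdx parS Gp U f)) →
        ∀ A : FBondY x.toKIdx → Matrix (Fin N) (Fin N) ℂ,
          γ * ∑ b, (x.toKIdx.cf ^ 2 * ((((θ.ℓ₆ : ℝ) + 1) ^ levV1 x.toKIdx b.src)⁻¹) ^ 2) * ∑ a, ∑ c, ‖A b a c‖ ^ 2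
            ≤ trIP (fun _ => (1 : ℝ)) A (deltaAY x.toKIdx parS (parBY x.toKIdx) Gp U A) := by
  classical
  haveI : Nonempty (Fin N) := ⟨⟨0, hN⟩⟩
  -- [4] Lemma 2.1 (2.61): uniform row sums at rate `δ_A∕2`
  obtain ⟨ML, Crow, hrowC⟩ := rowSum_geo9K_core (d := θ.d₆) (ℓ := θ.ℓ₆) (hd := θ.hd') (hL := θ.hL') (b₀ := θ.b₀) (b₁ := θ.b₁)
    (κ := δA / 2) (half_pos hδA)
  -- constants
  set L : ℝ := (θ.ℓ₆ : ℝ) + 1 with hLdef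
  have hL1 : 1 ≤ L := by rw [hLdef]; have : (0 : ℝ) ≤ θ.ℓ₆ := Nat.cast_nonneg _; linarith
  have hL0 : 0 < L := lt_of_lt_of_le one_pos hL1
  set R : ℝ := max (KA * L ^ |(1 : ℝ)| * Crow) 1 with hRdef
  have hR1 : 1 ≤ R := le_max_right _ _
  have hR0 : 0 < R := lt_of_lt_of_le one_pos hR1
  have he4 : 0 < Real.exp 4 := Real.exp_pos _
  set εc : ℝ := 12 * ((θ.d₆ : ℝ) + 1) * L ^ 2 * (40 * Real.exp 4 * L ^ 3) with hεc
  have hεc0 : 0 < εc := by positivity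
  set Mtr : ℝ := |(1 : ℝ)| * Real.log L / (δA / 2 * (2 * L ^ 2 - 1)) with hMtr
  set abud : ℝ := min 1 (min (1 / (10 * L)) (min (1 / (40 * Real.exp 4 * L ^ 3)) (1 / (2 * εc * R)))) with habud
  have habud0 : 0 < abud := by positivity
  refine ⟨max 1 (max ML (max Mtr 1)), abud, R⁻¹, lt_of_lt_of_le one_pos (le_max_left _ _), habud0, inv_pos.2 hR0, ?_⟩
  intro x hsurj hM α₀ hα ha U hU parS Gp hunit hmaj hsymmA hRpsd A
  have hG : specialUnitaryUnits (Fin N) ≤ B7Prop2Explicit.unitaryUnits (Matrix (Fin N) (Fin N) ℂ) := specialUnitaryUnits_le_unitaryUnits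
  have hUG : ∀ μ z, U μ z ∈ specialUnitaryUnits (Fin N) := hU.1.1
  have hU' : ∀ μ z, ((U μ z : (Matrix (Fin N) (Fin N) ℂ)ˣ) : Matrix (Fin N) (Fin N) ℂ) ∈ unitary (Matrix (Fin N) (Fin N) ℂ) :=
    fun μ z => hG (hUG μ z)
  -- `Δ_a ≥ Δ` as forms from the laws: `⟨D*A, R D*A⟩ ≥ 0` and `⟨QA, aQA⟩ = ‖QA‖²_w ≥ 0`
  have hΔle : ∀ A' : FBondY x.toKIdx → Matrix (Fin N) (Fin N) ℂ,
      trIP (fun _ => (1 : ℝ)) A' (hessY x.toKIdx U A') ≤ trIP (fun _ => (1 : ℝ)) A' (deltaAY x.toKIdx parS (parBY x.toKIdx) Gp U A') := by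
    intro A'
    rw [deltaAY, LinearMap.add_apply, LinearMap.add_apply, trIP_add_right, trIP_add_right, add_assoc]
    refine le_add_of_nonneg_right (add_nonneg ?_ ?_)
    · rw [LinearMap.comp_apply, LinearMap.comp_apply, trIP_comm, isAdjTr_gradY_divY x.toKIdx U hU', trIP_comm]
      exact hRpsd _
    · rw [LinearMap.comp_apply, LinearMap.comp_apply, ← isAdjTr_QY_QsY_parBY x.toKIdx hG U hUG, trIP_aY_eq]
      exact trIP_self_nonneg _ x.toKIdx.hw _
  -- the member's letters
  have hLK : (kGeo x.toKIdx).L = L := by rw [hLdef]; show (((θ.ℓ₆ + 1 : ℕ) : ℝ)) = _; push_cast; ring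
  have hLK9 : (geo9K x.toKIdx).L = L := hLK
  have hMK' : (kGeo x.toKIdx).M = (geo9Y x).M := rfl
  have hMK9 : (geo9K x.toKIdx).M = (geo9Y x).M := rfl
  have hMα : 0 ≤ (geo9Y x).M * α₀ := mul_nonneg (geo9Y_M_nonneg θ Mstar x) hα.le
  have ha3 : (geo9Y x).M * α₀ ≤ 1 / (10 * L) := ha.trans ((min_le_right _ _).trans (min_le_left _ _))
  have ha4 : (geo9Y x).M * α₀ ≤ 1 / (40 * Real.exp 4 * L ^ 3) :=
    ha.trans ((min_le_right _ _).trans ((min_le_right _ _).trans (min_le_left _ _)))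
  have ha5 : (geo9Y x).M * α₀ ≤ 1 / (2 * εc * R) :=
    ha.trans ((min_le_right _ _).trans ((min_le_right _ _).trans (min_le_right _ _)))
  -- a section of `β` and the weight letter `ℓ(b) = ℓ(ιB(blkV1 b))`
  obtain ⟨ιB, hι⟩ : ∃ ιB : BlkY x.toKIdx → IBondY x.toKIdx, ∀ s, β x.hN x.D x.hk (ιB s) = s :=
    ⟨fun s => (hsurj s).choose, fun s => (hsurj s).choose_spec⟩
  obtain ⟨wl, hwl⟩ : ∃ wl : FBondY x.toKIdx → ℝ, ∀ b', wl b' = (geo9K x.toKIdx).len (ιB (blkV1 x.hN x.D b')) := ⟨_, fun _ => rfl⟩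
  have hwl0 : ∀ b', 0 < wl b' := fun b' => by rw [hwl]; exact geo9K_len_pos x.toKIdx _
  have hwl1 : ∀ b', wl b' ≠ 0 := fun b' => (hwl0 b').ne'
  -- `S⁻¹ := M_{ℓ⁻¹} G M_{ℓ⁻¹}` is a left inverse of `S := M_ℓ Δ_a M_ℓ`
  have hGΔ : ∀ Φ, GAY x.toKIdx parS (parBY x.toKIdx) Gp U
      (deltaAY x.toKIdx parS (parBY x.toKIdx) Gp U Φ) = Φ := by
    intro Φ
    rw [← Module.End.mul_apply, GAY_mul_deltaAY x.toKIdx hunit, Module.End.one_apply]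
  have hinv := sandwich_leftInv (r := wl) hwl1 hGΔ
  -- (ii) the (2.51) majorant of `conj b S⁻¹` (the displayed block majorant, diagonal sandwich) and its row sums
  have hmajG := hmaj ιB hι
  have hmajS := hasMajorant_conj_sandwich (basis39 (Matrix (Fin N) (Fin N) ℂ)) (g := toB6 (geo9K x.toKIdx) 0 True)
    (fun b' : FBondY x.toKIdx => ιB (blkV1 x.hN x.D b')) (geo9K x.toKIdx).len (geo9K_len_pos x.toKIdx)
    (r := fun b' => (wl b')⁻¹) (fun b' => by rw [hwl, abs_of_pos (inv_pos.2 (geo9K_len_pos x.toKIdx _))]) hmajG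
  have hML : ML ≤ (geo9K x.toKIdx).M := by rw [hMK9]; exact ((le_max_left _ _).trans (le_max_right _ _)).trans hM
  have hMtr' : Mtr ≤ (geo9Y x).M := ((le_max_left _ _).trans ((le_max_right _ _).trans (le_max_right _ _))).trans hM
  have hMlog : |(1 : ℝ)| * Real.log (geo9K x.toKIdx).L ≤ δA / 2 * (2 * ((θ.ℓ₆ : ℝ) + 1) ^ 2 - 1) * (geo9K x.toKIdx).M := by
    have hden : 0 < δA / 2 * (2 * L ^ 2 - 1) := by
      have : 1 ≤ L ^ 2 := one_le_pow₀ hL1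
      have : 0 < 2 * L ^ 2 - 1 := by linarith
      positivity
    have h := (div_le_iff₀ hden).1 hMtr'
    rw [hLK9, hMK9, ← hLdef]
    linarith
  have hrowS : ∀ a, ∑ a', KA * (geo9K x.toKIdx).len a * ((geo9K x.toKIdx).len a')⁻¹ * Real.exp (-(δA * (geo9K x.toKIdx).dist a a')) ≤ R := by
    intro a
    refine (rowSum_weighted_le x.toKIdx hδA hKA (hrowC x.toKIdx hML) hMlog a).trans ?_
    rw [hRdef, hLK9]
    exact le_max_left _ _
  -- hence every real eigenvalue `λ` of `S` has `|λ| ≥ R⁻¹`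
  have heig := inv_le_abs_eigen_of_leftInv (basis39 (Matrix (Fin N) (Fin N) ℂ)) (g := toB6 (geo9K x.toKIdx) 0 True)
    (fun p : FBondY x.toKIdx × κ39 (Matrix (Fin N) (Fin N) ℂ) => ιB (blkV1 x.hN x.D p.1)) hinv hmajS hR0 hrowS
  -- (i) the form bound: the class's plaquette window and (3.26) + (3.69) in scale-weighted form
  have hK1 : 10 * (kGeo x.toKIdx).L * ((kGeo x.toKIdx).M * α₀) ≤ 1 := by
    rw [hLK, hMK']
    have := (le_div_iff₀ (by positivity : (0 : ℝ) < 10 * L)).1 ha3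
    linarith
  obtain ⟨δh, hδh⟩ : ∃ δh : ℝ, δh = 40 * Real.exp 4 * L ^ 3 * ((geo9Y x).M * α₀) := ⟨_, rfl⟩
  have hδh0 : 0 ≤ δh := by rw [hδh]; positivity
  have hδh1 : δh ≤ 1 := by
    have := (le_div_iff₀ (by positivity : (0 : ℝ) < 40 * Real.exp 4 * L ^ 3)).1 ha4
    rw [hδh]; linarith
  have hplaq : ∀ p : PlaqY x.toKIdx, ‖((holY x.toKIdx U p : (Matrix (Fin N) (Fin N) ℂ)ˣ) : Matrix (Fin N) (Fin N) ℂ) - 1‖ ≤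
      δh * ((((θ.ℓ₆ : ℝ) + 1) ^ levV1 x.toKIdx p.src)⁻¹) ^ 2 := by
    intro p
    have h := norm_holY_sub_one_le_window_of_reg335P x.toKIdx U (by norm_num [c35Y]) (by rw [hMK']; exact hMα) hK1 hU.1 p
    rw [hLK, hMK'] at h
    rw [hδh]
    exact h
  have hform := form_sandwich_ge (ε := 12 * ((θ.d₆ : ℝ) + 1) * ((θ.ℓ₆ : ℝ) + 1) ^ 2 * δh) wl
    (fun b' : FBondY x.toKIdx => x.toKIdx.cf ^ 2 * ((((θ.ℓ₆ : ℝ) + 1) ^ levV1 x.toKIdx b'.src)⁻¹) ^ 2)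
    (fun b' => by rw [hwl]; exact len_sq_mul_weight x.toKIdx ιB hι b')
    (fun A' => (trIP_hessY_ge_neg_weighted x.toKIdx hU' hδh0 hδh1 hplaq A').trans (hΔle A'))
  -- symmetry of `S`
  have hsymm := isSymmTr_sandwich wl hsymmA
  -- (iii) the gap `ε·R < 1`
  have hεK : 12 * ((θ.d₆ : ℝ) + 1) * ((θ.ℓ₆ : ℝ) + 1) ^ 2 * δh * R < 1 := by
    have h0 : 12 * ((θ.d₆ : ℝ) + 1) * ((θ.ℓ₆ : ℝ) + 1) ^ 2 * δh = εc * ((geo9Y x).M * α₀) := by rw [hδh, hεc, hLdef]; ring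
    rw [h0]
    have h2 : εc * ((geo9Y x).M * α₀) * R ≤ εc * (1 / (2 * εc * R)) * R :=
      mul_le_mul_of_nonneg_right (mul_le_mul_of_nonneg_left ha5 hεc0.le) hR0.le
    have h3 : εc * (1 / (2 * εc * R)) * R = 1 / 2 := by field_simp
    linarith
  -- `S ≥ R⁻¹` as forms; un-sandwich in the weight `wl⁻² = c_f²(L^{lev})⁻²`
  have hgap := form_ge_of_isSymmTr_of_form_ge_of_eigen_abs_ge (w := fun _ => (1 : ℝ)) (fun _ => one_pos) _ hsymm hR0 hεK hform heig
  have hA := form_ge_weighted_of_sandwich wl hwl1 hgap A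
  have hwt : ∀ b' : FBondY x.toKIdx, ((wl b')⁻¹) ^ 2 = x.toKIdx.cf ^ 2 * ((((θ.ℓ₆ : ℝ) + 1) ^ levV1 x.toKIdx b'.src)⁻¹) ^ 2 := by
    intro b'
    have h1 := len_sq_mul_weight x.toKIdx ιB hι b'
    rw [← hwl] at h1
    rw [inv_pow, ← one_div, div_eq_iff (pow_ne_zero 2 (hwl1 b')), mul_comm]
    exact h1.symm
  simp only [hwt] at hA
  exact hA

/-! ## §2 ★★ Row 17 at the knit letter, parametric site transporter, block in majorant currency -/

/-- ★★ **ROW 17 AT THE KNIT LETTER AT A PARAMETRIC SITE TRANSPORTER, THEOREM 3.3's BLOCK IN MAJORANT CURRENCY**: `posDefTr_deltaAQY_QknitY_of_laws` with the `EBlock`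
law replaced by the majorant law of §1: with `IsUnit Δ_a(U)`, the majorant, `Δ_a(U)` symmetric, `R(U) ≥ 0`, a partner `𝔮s` adjoint to `QknitY x` at `U`, and the
x-free numerics `0 < α₀′ ≤ α_Q`, `K_pl(Mα₀)L⁴ < α₀′`, `δ(2√(2b₁)+δ) < γ` (`δ = α₀′m₀√(2Nb₁)`): `PosDefTr 1 (deltaAQY x (QknitY x) 𝔮s parS Gp U)`.
[cite: Balaban1985BackgroundPropagators, Thm 3.11 p.416; Thm 3.3 p.399; (3.26) p.395; (3.12)–(3.15) pp.392–393; (3.115) p.419; (3.35) p.396; Balaban1985Averaging, (139)–(147) pp.39–40] -/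
theorem posDefTr_deltaAQY_QknitY_of_majorant [∀ i' : KIdx θ.d₆ θ.ℓ₆ θ.hd' θ.hL' θ.b₀ θ.b₁, Fintype (geo9K i').Site] {δA KA : ℝ} (hδA : 0 < δA)
    (hKA : 0 ≤ KA) :
    ∃ M₁ a₁ γ : ℝ, 0 < M₁ ∧ 0 < a₁ ∧ 0 < γ ∧
    ∀ (x : MemberY θ.d₆ θ.ℓ₆ θ.hd' θ.hL' θ.b₀ θ.b₁ Mstar), Function.Surjective (β x.hN x.D x.hk) → M₁ ≤ (geo9Y x).M →
      ∀ α₀ : ℝ, 0 < α₀ → (geo9Y x).M * α₀ ≤ a₁ →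
      ∀ U : CfgY (Matrix (Fin N) (Fin N) ℂ) x.toKIdx,
        (bg9YP (Matrix (Fin N) (Fin N) ℂ) (specialUnitaryUnits (Fin N)) x).Reg335 c35Y α₀ U →
        ∀ (parS : SiteParY (Matrix (Fin N) (Fin N) ℂ) x.toKIdx) (Gp : SiteOpY (Matrix (Fin N) (Fin N) ℂ) x.toKIdx),
          IsUnit (deltaAY x.toKIdx parS (parBY x.toKIdx) Gp U) →
          (∀ (ιB : BlkY x.toKIdx → IBondY x.toKIdx), (∀ s, β x.hN x.D x.hk (ιB s) = s) →
            HasMajorant (g := toB6 (geo9K x.toKIdx) 0 True) (fun p : FBondY x.toKIdx × κ39 (Matrix (Fin N) (Fin N) ℂ) => ιB (blkV1 x.hN x.D p.1))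
              (conj (basis39 (Matrix (Fin N) (Fin N) ℂ)) ((GAY x.toKIdx parS (parBY x.toKIdx) Gp U).restrictScalars ℝ))
              (fun a a' => KA * (geo9K x.toKIdx).len a ^ 2 * Real.exp (-(δA * (geo9K x.toKIdx).dist a a')))) →
          IsSymmTr (fun _ => (1 : ℝ)) (deltaAY x.toKIdx parS (parBY x.toKIdx) Gp U) →
          (∀ f, 0 ≤ trIP (fun _ => (1 : ℝ)) f (RY x.toKIdx parS Gp U f)) →
        ∀ (𝔮s : CfgY (Matrix (Fin N) (Fin N) ℂ) x.toKIdx →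
              ((IBondY x.toKIdx → Matrix (Fin N) (Fin N) ℂ) →ₗ[ℂ] (FBondY x.toKIdx → Matrix (Fin N) (Fin N) ℂ))),
          IsAdjTr (fun _ => (1 : ℝ)) (fun _ => (1 : ℝ)) (QknitY x.toKIdx U) (𝔮s U) →
        ∀ α₀' : ℝ, 0 < α₀' → α₀' ≤ alphaQ (θ.d₆ + 1) (θ.ℓ₆ + 1) →
          Kpl x.toKIdx ((geo9Y x).M * α₀) * (((θ.ℓ₆ : ℝ) + 1)) ^ 4 < α₀' →
          (α₀' * (2 * ((θ.d₆ : ℝ) + 1) * kCol (θ.d₆ + 1) (θ.ℓ₆ + 1) + 8 * ((θ.d₆ : ℝ) + 2) ^ 2) * Real.sqrt (2 * (N : ℝ) * θ.b₁))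
              * (2 * Real.sqrt (2 * θ.b₁)
                + α₀' * (2 * ((θ.d₆ : ℝ) + 1) * kCol (θ.d₆ + 1) (θ.ℓ₆ + 1) + 8 * ((θ.d₆ : ℝ) + 2) ^ 2) * Real.sqrt (2 * (N : ℝ) * θ.b₁)) < γ →
          PosDefTr (fun _ => (1 : ℝ))
            (deltaAQY x.toKIdx (QknitY x.toKIdx) 𝔮s parS Gp U) := by
  have hN : 1 ≤ N := Fin.pos_iff_nonempty.2 inferInstance
  obtain ⟨M₁, a₁, γ, hM₁, ha₁, hγ, h⟩ := formGap_deltaAY_of_majorant (N := N) θ Mstar hN hδA hKA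
  refine ⟨M₁, a₁, γ, hM₁, ha₁, hγ, fun x hsurj hM α₀ hα ha U hU parS Gp hunit hE hsymmA hRpsd 𝔮s hQ α₀' hα' hαQ hK hβ => ?_⟩
  have hGU : specialUnitaryUnits (Fin N) ≤ B7Prop2Explicit.unitaryUnits (Matrix (Fin N) (Fin N) ℂ) := specialUnitaryUnits_le_unitaryUnits
  have hb₁ : 0 ≤ θ.b₁ := le_trans θ.hb.1.le θ.hb.2
  have hreg : (bg9KP (Matrix (Fin N) (Fin N) ℂ) (specialUnitaryUnits (Fin N)) x.toKIdx).Reg335 c35Y α₀ U := hU.1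
  have hMα : 0 ≤ (kGeo x.toKIdx).M * α₀ := mul_nonneg (B9Thm39OneCubeReadingAtLettersY.geo9Y_M_nonneg θ Mstar x) hα.le
  have hLK : (kGeo x.toKIdx).L = (θ.ℓ₆ : ℝ) + 1 := by show (((θ.ℓ₆ + 1 : ℕ) : ℝ)) = _; push_cast; ring
  have hK' : Kpl x.toKIdx ((kGeo x.toKIdx).M * α₀) * (kGeo x.toKIdx).L ^ 4 < α₀' := by rw [hLK]; exact hK
  -- the row transports of dag-n06-l, kept opaque
  obtain ⟨T, hT⟩ : ∃ T : IBondY x.toKIdx → (Matrix (Fin N) (Fin N) ℂ)ˣ, ∀ ι, T ι =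
      (parTaxiV U (B15DeterminingSets.embIter (ι.1.1 : ℕ) ι.1.2.src)
        (B10Eq27TorusAxialLog.transl (0 : Site (PV θ.d₆ θ.ℓ₆ x.toKIdx.m x.toKIdx.K θ.hd' θ.hL') 0)
          (B7Prop1Local.loK (θ.ℓ₆ + 1) (ι.1.1 : ℕ) (zSrc x.toKIdx ι))))⁻¹ := ⟨_, fun _ => rfl⟩
  have hTc : ∀ ι, ‖(T ι : Matrix (Fin N) (Fin N) ℂ)‖ ≤ 1 ∧ ‖(((T ι)⁻¹ : (Matrix (Fin N) (Fin N) ℂ)ˣ) : Matrix (Fin N) (Fin N) ℂ)‖ ≤ 1 := by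
    intro ι
    rw [hT ι]
    exact B9Ineq349SiteFromConv342.contractive_of_mem hGU (rebase_mem x.toKIdx hU.1.1 ι)
  have hm₀0 : 0 ≤ 2 * ((θ.d₆ : ℝ) + 1) * kCol (θ.d₆ + 1) (θ.ℓ₆ + 1) + 8 * ((θ.d₆ : ℝ) + 2) ^ 2 := by
    have := kCol_nonneg (θ.d₆ + 1) (θ.ℓ₆ + 1); positivity
  have hδ0 : 0 ≤ α₀' * (2 * ((θ.d₆ : ℝ) + 1) * kCol (θ.d₆ + 1) (θ.ℓ₆ + 1) + 8 * ((θ.d₆ : ℝ) + 2) ^ 2) * Real.sqrt (2 * (N : ℝ) * θ.b₁) := by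
    positivity
  have hwgt : ∀ b : FBondY x.toKIdx, 0 < x.toKIdx.cf ^ 2 * ((((θ.ℓ₆ : ℝ) + 1) ^ levV1 x.toKIdx b.src)⁻¹) ^ 2 := by
    intro b
    have hcf : x.toKIdx.cf ≠ 0 := x.toKIdx.hcf
    have hL : (0 : ℝ) < ((θ.ℓ₆ : ℝ) + 1) ^ levV1 x.toKIdx b.src := pow_pos (by positivity) _
    positivity
  have hwsum : ∀ A : FBondY x.toKIdx → Matrix (Fin N) (Fin N) ℂ,
      trIP (fun b => x.toKIdx.cf ^ 2 * ((((θ.ℓ₆ : ℝ) + 1) ^ levV1 x.toKIdx b.src)⁻¹) ^ 2) A A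
        = ∑ b, (x.toKIdx.cf ^ 2 * ((((θ.ℓ₆ : ℝ) + 1) ^ levV1 x.toKIdx b.src)⁻¹) ^ 2) * ∑ a, ∑ c, ‖A b a c‖ ^ 2 :=
    fun A => trIP_self_eq_sum _ A
  refine posDefTr_deltaAQY_of_formGap_of_close_rebased x.toKIdx hGU parS Gp (fun s s' => parBY_mem x.toKIdx hU.1.1 s s') hQ
    (fun A => trIP_w_eq_of_rowRebase x.toKIdx (parBY x.toKIdx) U
      (trLiftY (1 : Matrix (IBondY x.toKIdx) (IBondY x.toKIdx) ℝ) (fun ι' _ => T ι') ∘ₗ QY x.toKIdx (parBY x.toKIdx) U) T hTc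
      (fun A ι => rebaseRef_apply x.toKIdx T (parBY x.toKIdx) U A ι) A)
    hwgt (Real.sqrt_nonneg _) hδ0 (fun A => ?_) (fun A => ?_) (fun A => ?_) hβ
  · rw [hwsum]; exact h x hsurj hM α₀ hα ha U hU parS Gp hunit hE hsymmA hRpsd A
  · rw [hwsum]; exact trIP_w_QY_parBY_le_member θ Mstar x hU.1.1 A
  -- the closeness in the `trIP` currency
  rw [hwsum]
  have hclose := trIP_w_QknitY_sub_rebase_le x.toKIdx hGU hb₁ (show c35Y ≤ 10 by norm_num [c35Y]) hMα hreg hα' hαQ hK' T hT A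
  have hfun : (QknitY x.toKIdx U - trLiftY (1 : Matrix (IBondY x.toKIdx) (IBondY x.toKIdx) ℝ) (fun ι' _ => T ι') ∘ₗ QY x.toKIdx (parBY x.toKIdx) U) A
      = fun ι => QknitY x.toKIdx U A ι - B9Eq39Adjoint.R (T ι) (QY x.toKIdx (parBY x.toKIdx) U A ι) := by
    funext ι
    rw [LinearMap.sub_apply, Pi.sub_apply, rebaseRef_apply]
  have hδsq : (α₀' * (2 * ((θ.d₆ : ℝ) + 1) * kCol (θ.d₆ + 1) (θ.ℓ₆ + 1) + 8 * ((θ.d₆ : ℝ) + 2) ^ 2) * Real.sqrt (2 * (N : ℝ) * θ.b₁)) ^ 2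
      = (α₀' * (2 * ((θ.d₆ : ℝ) + 1) * kCol (θ.d₆ + 1) (θ.ℓ₆ + 1) + 8 * ((θ.d₆ : ℝ) + 2) ^ 2)) ^ 2 * (2 * (N : ℝ) * θ.b₁) := by
    rw [mul_pow, Real.sq_sqrt (by positivity)]
  rw [hfun, hδsq]
  exact hclose

end Record

/-! ## §3 ★★★ At the knit site table and the knit pair of record: every law and every knit numeric discharged (section-carrying members) -/

section KnitRecord

open scoped Matrix.Norms.L2Operator
open B7Prop2SpecialUnitary

variable {N : ℕ} [Nonempty (Fin N)] (θ : Stage3Params) (Mstar : ℕ)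

/-- **THE KNIT NUMERICS FROM THE GUARD**: for `0 < a ≤ α_Q` and `M·α₀ ≤ min (1∕(10L)) (a∕(2·40e⁴L⁵))` (`0 ≤ M·α₀`), `K_pl(Mα₀)·L⁴ < a` — [5]'s two Prop.-2 windows are read
off `α_Q` downstream. [cite: Balaban1985BackgroundPropagators, (3.69) p.404, (3.35) p.396; Balaban1985Averaging, Prop. 2 (52) p.26, bookkeeping] -/
theorem Kpl_mul_L4_lt_of_guard (x : MemberY θ.d₆ θ.ℓ₆ θ.hd' θ.hL' θ.b₀ θ.b₁ Mstar) {α₀ a : ℝ} (hMα : 0 ≤ (geo9Y x).M * α₀) (ha : 0 < a)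
    (h1 : (geo9Y x).M * α₀ ≤ 1 / (10 * (((θ.ℓ₆ : ℝ)) + 1)))
    (h2 : (geo9Y x).M * α₀ ≤ a / (2 * (40 * Real.exp 4 * (((θ.ℓ₆ : ℝ)) + 1) ^ 5))) :
    Kpl x.toKIdx ((geo9Y x).M * α₀) * (((θ.ℓ₆ : ℝ) + 1)) ^ 4 < a := by
  have hLK : (kGeo x.toKIdx).L = (θ.ℓ₆ : ℝ) + 1 := by show (((θ.ℓ₆ + 1 : ℕ) : ℝ)) = _; push_cast; ring
  have hL0 : (0 : ℝ) < (θ.ℓ₆ : ℝ) + 1 := by positivity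
  have ht1 : 10 * (kGeo x.toKIdx).L * ((geo9Y x).M * α₀) ≤ 1 := by
    rw [hLK]
    have := (le_div_iff₀ (by positivity : (0 : ℝ) < 10 * ((θ.ℓ₆ : ℝ) + 1))).1 h1
    linarith
  have hta : 40 * Real.exp 4 * (kGeo x.toKIdx).L ^ 5 * ((geo9Y x).M * α₀) < a := by
    rw [hLK]
    have hP : (0 : ℝ) < 2 * (40 * Real.exp 4 * ((θ.ℓ₆ : ℝ) + 1) ^ 5) := by positivity
    have := (le_div_iff₀ hP).1 h2
    linarith only [this, ha]
  have h := Kpl_lt_of_le x.toKIdx hMα ht1 hta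
  rw [hLK] at h
  exact h

/-- ★★★ **THEOREM 3.11's SCALE-WEIGHTED GAP AT THE KNIT SITE TABLE `(parKnitY, GpY parKnitY)`, LAW-FREE** at section-carrying members on (3.35): there are
`M₁, a₁, γ > 0` with: `β` onto, `M₁ ≦ M`, `0 < α₀`, `M·α₀ ≦ a₁`, `SU(N)`-valued `U ∈ (bg9YP … x).Reg335 c₃₅ α₀` ⟹ `γ·Σ_b c_f²(L^{lev b})⁻²‖A b‖²_HS ≤ ⟨A, Δ_a(U; parKnitY)A⟩₁`
for every `A`.  Theorem 3.3's block at `parKnitY` from `isUnit_deltaAY_parKnitY_and_majorant_of_regYP335_section`; symmetry and `R ≥ 0` from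
`B9Thm311PosDefQknitAtKnitSiteTableY` §1 at `α₀′ := α_Q`, the knit numerics folded into `M·α₀ ≦ a₁`.
[cite: Balaban1985BackgroundPropagators, Thm 3.11 p.416; Thm 3.3 p.399; (3.19) p.393; (3.26) p.395; (3.35) p.396; (3.69) p.404; Balaban1984PropagatorsII, Lemma 2.1 (2.60)–(2.61) p.234; Balaban1985Averaging, Prop. 2 (52)–(53) p.26] -/
theorem formGap_deltaAY_parKnitY_at_scMember :
    ∃ M₁ a₁ γ : ℝ, 0 < M₁ ∧ 0 < a₁ ∧ 0 < γ ∧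
    ∀ (x : MemberY θ.d₆ θ.ℓ₆ θ.hd' θ.hL' θ.b₀ θ.b₁ Mstar), Function.Surjective (β x.hN x.D x.hk) → M₁ ≤ (geo9Y x).M →
      ∀ α₀ : ℝ, 0 < α₀ → (geo9Y x).M * α₀ ≤ a₁ →
      ∀ U : CfgY (Matrix (Fin N) (Fin N) ℂ) x.toKIdx,
        (bg9YP (Matrix (Fin N) (Fin N) ℂ) (specialUnitaryUnits (Fin N)) x).Reg335 c35Y α₀ U →
        ∀ A : FBondY x.toKIdx → Matrix (Fin N) (Fin N) ℂ,
          γ * ∑ b, (x.toKIdx.cf ^ 2 * ((((θ.ℓ₆ : ℝ) + 1) ^ levV1 x.toKIdx b.src)⁻¹) ^ 2) * ∑ a, ∑ c, ‖A b a c‖ ^ 2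
            ≤ trIP (fun _ => (1 : ℝ)) A
                (deltaAY x.toKIdx (parKnitY x.toKIdx) (parBY x.toKIdx) (GpY x.toKIdx (parKnitY x.toKIdx)) U A) := by
  classical
  have hN : 1 ≤ N := Fin.pos_iff_nonempty.2 inferInstance
  haveI instK : ∀ i' : KIdx θ.d₆ θ.ℓ₆ θ.hd' θ.hL' θ.b₀ θ.b₁, Fintype (geo9K i').Site := fun i' => (kGeoU i').fin
  haveI instD : ∀ i' : KIdx θ.d₆ θ.ℓ₆ θ.hd' θ.hL' θ.b₀ θ.b₁, DecidableEq (geo9K i').Site := fun i' => Classical.decEq _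
  obtain ⟨M₁K, a₁K, δK, CK, hM₁K, ha₁K, hδK, hCK, HK⟩ := isUnit_deltaAY_parKnitY_and_majorant_of_regYP335_section (N := N) θ Mstar hN
  obtain ⟨M₁, a₁, γ, hM₁, ha₁, hγ, h⟩ := formGap_deltaAY_of_majorant (N := N) θ Mstar hN hδK hCK
  have he4 : 0 < Real.exp 4 := Real.exp_pos _
  have hL0 : (0 : ℝ) < (θ.ℓ₆ : ℝ) + 1 := by positivity
  have hαQ0 : 0 < alphaQ (θ.d₆ + 1) (θ.ℓ₆ + 1) := alphaQ_pos _ (Nat.le_add_left 1 θ.ℓ₆)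
  set a₂ : ℝ := min (1 / (10 * (((θ.ℓ₆ : ℝ)) + 1))) (alphaQ (θ.d₆ + 1) (θ.ℓ₆ + 1) / (2 * (40 * Real.exp 4 * (((θ.ℓ₆ : ℝ)) + 1) ^ 5))) with ha₂
  have ha₂0 : 0 < a₂ := lt_min (by positivity) (div_pos hαQ0 (by positivity))
  refine ⟨max M₁K M₁, min a₁K (min a₁ a₂), γ, lt_of_lt_of_le hM₁K (le_max_left _ _), lt_min ha₁K (lt_min ha₁ ha₂0), hγ,
    fun x hsurj hM α₀ hα ha U hU A => ?_⟩
  have hMα : 0 ≤ (geo9Y x).M * α₀ := mul_nonneg (geo9Y_M_nonneg θ Mstar x) hα.le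
  have hK : Kpl x.toKIdx ((geo9Y x).M * α₀) * (((θ.ℓ₆ : ℝ) + 1)) ^ 4 < alphaQ (θ.d₆ + 1) (θ.ℓ₆ + 1) :=
    Kpl_mul_L4_lt_of_guard θ Mstar x hMα hαQ0 ((ha.trans ((min_le_right _ _).trans (min_le_right _ _))).trans (min_le_left _ _))
      ((ha.trans ((min_le_right _ _).trans (min_le_right _ _))).trans (min_le_right _ _))
  obtain ⟨hunit, hmaj⟩ := HK x hsurj ((le_max_left _ _).trans hM) α₀ hα (ha.trans (min_le_left _ _)) U hU
  exact h x hsurj ((le_max_right _ _).trans hM) α₀ hα (ha.trans ((min_le_right _ _).trans (min_le_left _ _))) U hU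
    (parKnitY x.toKIdx) (GpY x.toKIdx (parKnitY x.toKIdx)) hunit hmaj
    (deltaAY_parKnitY_isSymmTr_at_member θ Mstar x hα hU hαQ0 le_rfl hK)
    (trIP_RY_parKnitY_self_nonneg_at_member θ Mstar x hα hU hαQ0 le_rfl hK) A

/-- ★★★ **ROW 17 AND SYMMETRY AT THE KNIT RECORD, LAW-FREE** — dag-n06-d's displayed `hΔAK` conjunct AS A THEOREM at section-carrying members on (3.35): there are
`M₁, a₁ > 0` such that for `β` onto, `M₁ ≦ M`, `0 < α₀`, `M·α₀ ≦ a₁` and every `SU(N)`-valued `U ∈ (bg9YP … x).Reg335 c₃₅ α₀`, `Δ_a^𝔮(U)` at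
`(qKnitOfRecord, qsKnitOfRecord, parKnitY, GpY parKnitY)` is symmetric AND positive definite for the trace pairing.  Every law of
`symm_posDefTr_deltaAQY_knitRecord_of_block` is discharged: Theorem 3.3's block by `isUnit_deltaAY_parKnitY_and_majorant_of_regYP335_section` (majorant currency, §2),
the closeness numeric `δ(2√(2b₁)+δ) < γ` by fixing `α₀′ := min α_Q (min 1 (γ∕(2(W+1))))`, `W = s(2√(2b₁)+s)`, `s = m₀√(2Nb₁)`, and the knit numerics
`K_pl(Mα₀)L⁴ < α₀′` by the guard (`Kpl_mul_L4_lt_of_guard`). [cite: Balaban1985BackgroundPropagators, Thm 3.11 p.416; Thm 3.3 p.399; (3.19)–(3.27) pp.393–395; (3.35) p.396; (3.115) p.419; Balaban1985Averaging, Prop. 2 p.26, (139)–(147) pp.39–40] -/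
theorem symm_posDefTr_deltaAQY_knitRecord_at_scMember :
    ∃ M₁ a₁ : ℝ, 0 < M₁ ∧ 0 < a₁ ∧
    ∀ (x : MemberY θ.d₆ θ.ℓ₆ θ.hd' θ.hL' θ.b₀ θ.b₁ Mstar), Function.Surjective (β x.hN x.D x.hk) → M₁ ≤ (geo9Y x).M →
      ∀ α₀ : ℝ, 0 < α₀ → (geo9Y x).M * α₀ ≤ a₁ →
      ∀ U : CfgY (Matrix (Fin N) (Fin N) ℂ) x.toKIdx,
        (bg9YP (Matrix (Fin N) (Fin N) ℂ) (specialUnitaryUnits (Fin N)) x).Reg335 c35Y α₀ U →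
          IsSymmTr (fun _ => (1 : ℝ)) (deltaAQY x.toKIdx (qKnitOfRecord N θ x.toKIdx) (qsKnitOfRecord N θ x.toKIdx) (parKnitY x.toKIdx)
              (GpY x.toKIdx (parKnitY x.toKIdx)) U) ∧
            PosDefTr (fun _ => (1 : ℝ)) (deltaAQY x.toKIdx (qKnitOfRecord N θ x.toKIdx) (qsKnitOfRecord N θ x.toKIdx) (parKnitY x.toKIdx)
              (GpY x.toKIdx (parKnitY x.toKIdx)) U) := by
  classical
  have hN : 1 ≤ N := Fin.pos_iff_nonempty.2 inferInstance
  haveI instK : ∀ i' : KIdx θ.d₆ θ.ℓ₆ θ.hd' θ.hL' θ.b₀ θ.b₁, Fintype (geo9K i').Site := fun i' => (kGeoU i').fin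
  haveI instD : ∀ i' : KIdx θ.d₆ θ.ℓ₆ θ.hd' θ.hL' θ.b₀ θ.b₁, DecidableEq (geo9K i').Site := fun i' => Classical.decEq _
  obtain ⟨M₁K, a₁K, δK, CK, hM₁K, ha₁K, hδK, hCK, HK⟩ := isUnit_deltaAY_parKnitY_and_majorant_of_regYP335_section (N := N) θ Mstar hN
  obtain ⟨M₁, a₁, γ, hM₁, ha₁, hγ, h⟩ := posDefTr_deltaAQY_QknitY_of_majorant (N := N) θ Mstar hδK hCK
  have he4 : 0 < Real.exp 4 := Real.exp_pos _
  have hL0 : (0 : ℝ) < (θ.ℓ₆ : ℝ) + 1 := by positivity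
  have hαQ0 : 0 < alphaQ (θ.d₆ + 1) (θ.ℓ₆ + 1) := alphaQ_pos _ (Nat.le_add_left 1 θ.ℓ₆)
  have hb₁ : 0 ≤ θ.b₁ := le_trans θ.hb.1.le θ.hb.2
  -- the closeness numeric: `α₀′` fixed from `γ`
  set s : ℝ := (2 * ((θ.d₆ : ℝ) + 1) * kCol (θ.d₆ + 1) (θ.ℓ₆ + 1) + 8 * ((θ.d₆ : ℝ) + 2) ^ 2) * Real.sqrt (2 * (N : ℝ) * θ.b₁) with hs
  have hs0 : 0 ≤ s := by rw [hs]; have := kCol_nonneg (θ.d₆ + 1) (θ.ℓ₆ + 1); positivity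
  set W : ℝ := s * (2 * Real.sqrt (2 * θ.b₁) + s) with hW
  have hW0 : 0 ≤ W := by rw [hW]; exact mul_nonneg hs0 (add_nonneg (by positivity) hs0)
  have hW1 : 0 < 2 * (W + 1) := by linarith
  set αK : ℝ := min (alphaQ (θ.d₆ + 1) (θ.ℓ₆ + 1)) (min 1 (γ / (2 * (W + 1)))) with hαK
  have hαK0 : 0 < αK := lt_min hαQ0 (lt_min one_pos (div_pos hγ hW1))
  have hαKQ : αK ≤ alphaQ (θ.d₆ + 1) (θ.ℓ₆ + 1) := min_le_left _ _
  have hαK1 : αK ≤ 1 := (min_le_right _ _).trans (min_le_left _ _)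
  have hαKγ : αK ≤ γ / (2 * (W + 1)) := (min_le_right _ _).trans (min_le_right _ _)
  have hβ : (αK * (2 * ((θ.d₆ : ℝ) + 1) * kCol (θ.d₆ + 1) (θ.ℓ₆ + 1) + 8 * ((θ.d₆ : ℝ) + 2) ^ 2) * Real.sqrt (2 * (N : ℝ) * θ.b₁))
      * (2 * Real.sqrt (2 * θ.b₁)
        + αK * (2 * ((θ.d₆ : ℝ) + 1) * kCol (θ.d₆ + 1) (θ.ℓ₆ + 1) + 8 * ((θ.d₆ : ℝ) + 2) ^ 2) * Real.sqrt (2 * (N : ℝ) * θ.b₁)) < γ := by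
    have h1 : αK * (2 * ((θ.d₆ : ℝ) + 1) * kCol (θ.d₆ + 1) (θ.ℓ₆ + 1) + 8 * ((θ.d₆ : ℝ) + 2) ^ 2) * Real.sqrt (2 * (N : ℝ) * θ.b₁) = αK * s := by
      rw [hs]; ring
    rw [h1]
    have h2 : αK * s ≤ s := by nlinarith [mul_nonneg (sub_nonneg.2 hαK1) hs0]
    have h3 : 0 ≤ αK * s := mul_nonneg hαK0.le hs0
    have h4 : 0 ≤ 2 * Real.sqrt (2 * θ.b₁) := by positivity
    have h5 : αK * s * (2 * Real.sqrt (2 * θ.b₁) + αK * s) ≤ αK * W := by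
      rw [hW]
      calc αK * s * (2 * Real.sqrt (2 * θ.b₁) + αK * s) ≤ αK * s * (2 * Real.sqrt (2 * θ.b₁) + s) :=
            mul_le_mul_of_nonneg_left (by linarith) h3
        _ = αK * (s * (2 * Real.sqrt (2 * θ.b₁) + s)) := by ring
    have h6 : αK * W ≤ γ / (2 * (W + 1)) * W := mul_le_mul_of_nonneg_right hαKγ hW0
    have h7 : γ / (2 * (W + 1)) * W < γ := by
      rw [div_mul_eq_mul_div, div_lt_iff₀ hW1]
      nlinarith [mul_nonneg hγ.le hW0]
    linarith
  set a₂ : ℝ := min (1 / (10 * (((θ.ℓ₆ : ℝ)) + 1))) (αK / (2 * (40 * Real.exp 4 * (((θ.ℓ₆ : ℝ)) + 1) ^ 5))) with ha₂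
  have ha₂0 : 0 < a₂ := lt_min (by positivity) (div_pos hαK0 (by positivity))
  refine ⟨max M₁K M₁, min a₁K (min a₁ a₂), lt_of_lt_of_le hM₁K (le_max_left _ _), lt_min ha₁K (lt_min ha₁ ha₂0),
    fun x hsurj hM α₀ hα ha U hU => ?_⟩
  have hMα : 0 ≤ (geo9Y x).M * α₀ := mul_nonneg (geo9Y_M_nonneg θ Mstar x) hα.le
  have hK : Kpl x.toKIdx ((geo9Y x).M * α₀) * (((θ.ℓ₆ : ℝ) + 1)) ^ 4 < αK :=
    Kpl_mul_L4_lt_of_guard θ Mstar x hMα hαK0 ((ha.trans ((min_le_right _ _).trans (min_le_right _ _))).trans (min_le_left _ _))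
      ((ha.trans ((min_le_right _ _).trans (min_le_right _ _))).trans (min_le_right _ _))
  obtain ⟨hunit, hmaj⟩ := HK x hsurj ((le_max_left _ _).trans hM) α₀ hα (ha.trans (min_le_left _ _)) U hU
  have hsymmA := deltaAY_parKnitY_isSymmTr_at_member θ Mstar x hα hU hαK0 hαKQ hK
  refine ⟨?_, ?_⟩
  · exact deltaAQY_isSymmTr_of_deltaAY x.toKIdx le_rfl (parKnitY x.toKIdx) (GpY x.toKIdx (parKnitY x.toKIdx))
      (fun μ y => specialUnitaryUnits_le_unitaryUnits (hU.1.1 μ y)) (isAdjTr_adjTrY (QknitY x.toKIdx U)) hsymmA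
  · exact h x hsurj ((le_max_right _ _).trans hM) α₀ hα (ha.trans ((min_le_right _ _).trans (min_le_left _ _))) U hU
      (parKnitY x.toKIdx) (GpY x.toKIdx (parKnitY x.toKIdx)) hunit hmaj hsymmA
      (trIP_RY_parKnitY_self_nonneg_at_member θ Mstar x hα hU hαK0 hαKQ hK) (qsKnitOfRecord N θ x.toKIdx) (isAdjTr_adjTrY (QknitY x.toKIdx U))
      αK hαK0 hαKQ hK hβ

/-- ★★★ **THE SAME ON THE REGIME OF RECORD `bg9YR … R₁ R₂`** (the «K» certificates' class; its inclusion `hRP1` into (3.35) displayed as in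
`symm_posDefTr_deltaAQY_knitRecord_of_block_regYR`; threshold `c > 0`; smallness in the certificate's shape `M·α₀ ≦ a₁∕c`): the `hΔAK` conjunct of dag-n06-d's «KA»∕«KB»,
restricted to section-carrying members, with NO displayed law. [cite: Balaban1985BackgroundPropagators, Thm 3.11 p.416 with (3.35) p.396; Thm 3.3 p.399; (3.19) p.393] -/
theorem symm_posDefTr_deltaAQY_knitRecord_at_scMember_regYR
    {R₁ R₂ : B9BackgroundsKLevelV1R.RegFamY θ.d₆ θ.ℓ₆ θ.hd' θ.hL' θ.b₀ θ.b₁ Mstar (Matrix (Fin N) (Fin N) ℂ)} {c : ℝ} (hc : 0 < c)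
    (hRP1 : ∀ (x : MemberY θ.d₆ θ.ℓ₆ θ.hd' θ.hL' θ.b₀ θ.b₁ Mstar) (α₀ : ℝ)
      (U : (B9BackgroundsKLevelV1R.bg9YR (Matrix (Fin N) (Fin N) ℂ) (specialUnitaryUnits (Fin N)) R₁ R₂ x).Cfg),
      (B9BackgroundsKLevelV1R.bg9YR (Matrix (Fin N) (Fin N) ℂ) (specialUnitaryUnits (Fin N)) R₁ R₂ x).Reg335 c α₀ U →
        0 ≤ α₀ ∧ (bg9YP (Matrix (Fin N) (Fin N) ℂ) (specialUnitaryUnits (Fin N)) x).Reg335 c35Y α₀ U) :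
    ∃ M₁ a₁ : ℝ, 0 < M₁ ∧ 0 < a₁ ∧
    ∀ (x : MemberY θ.d₆ θ.ℓ₆ θ.hd' θ.hL' θ.b₀ θ.b₁ Mstar), Function.Surjective (β x.hN x.D x.hk) → M₁ ≤ (geo9Y x).M →
      ∀ α₀ : ℝ, 0 < α₀ → (geo9Y x).M * α₀ ≤ a₁ / c →
      ∀ U : (B9BackgroundsKLevelV1R.bg9YR (Matrix (Fin N) (Fin N) ℂ) (specialUnitaryUnits (Fin N)) R₁ R₂ x).Cfg,
        (B9BackgroundsKLevelV1R.bg9YR (Matrix (Fin N) (Fin N) ℂ) (specialUnitaryUnits (Fin N)) R₁ R₂ x).Reg335 c α₀ U →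
          IsSymmTr (fun _ => (1 : ℝ)) (deltaAQY x.toKIdx (qKnitOfRecord N θ x.toKIdx) (qsKnitOfRecord N θ x.toKIdx) (parKnitY x.toKIdx)
              (GpY x.toKIdx (parKnitY x.toKIdx)) U) ∧
            PosDefTr (fun _ => (1 : ℝ)) (deltaAQY x.toKIdx (qKnitOfRecord N θ x.toKIdx) (qsKnitOfRecord N θ x.toKIdx) (parKnitY x.toKIdx)
              (GpY x.toKIdx (parKnitY x.toKIdx)) U) := by
  obtain ⟨M₁, a₁, hM₁, ha₁, h⟩ := symm_posDefTr_deltaAQY_knitRecord_at_scMember (N := N) θ Mstar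
  refine ⟨M₁, a₁ * c, hM₁, mul_pos ha₁ hc, fun x hsurj hM α₀ hα ha U hU => ?_⟩
  have hac : a₁ * c / c = a₁ := by field_simp
  have ha' : (geo9Y x).M * α₀ ≤ a₁ := by rw [hac] at ha; exact ha
  exact h x hsurj hM α₀ hα ha' U (hRP1 x α₀ U hU).2

end KnitRecord

end Literature.MathematicalPhysics.QuantumFieldTheory.Balaban1983to89.B9Thm311PosDefQknitAtKnitLetterLawFreeY

end
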